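import Summits.AtomisticToContinuum.HydrodynamicLimit.Theorems.InformationPercolationEngineChaosClosesEulerReductionEntropy
import HarnessLib

/-!
# Kinetic reduction (crux `ChaosClosesEuler`, stmt-AtomisticToContinuum-15141, line `Sketch`,
# stub `stub_kineticReduction`) — helper: cold cones and the cold correction of the entropy hypothesis

WHAT. The deterministic BF18 shell of the line (skeleton v7, `BF18ShellHS`) clamps the entropy of an EXACTLY COLD
state to the lower cut-off value: its weight is `Z' = Z` on `{θ_r > 0}` and `Z' = a` on `{θ_r ≤ 0}`, `Z` the clamped
entropy `max a (min (3/2 log θ_r − log ρ_r − F ρ_r) b)`, whereas the clamped local second law (stmt-13352) is stated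
with `Z` everywhere. This file prices the difference along ONE good orbit whose configurations have pairwise
distinct velocities at all times (a null event off which the reduction works, helper `ReductionCoincidence`):

* `rhoC_le_of_thetaC_nonpos` — a cone of nonpositive coarse temperature holds at most ONE particle (equality in
  the Cauchy–Schwarz inequality `‖m_r‖² ≤ 2ρ_r e_r` forces all particles of the cone onto one velocity), so its
  density is at most one kernel peak per particle, `ρ_r ≤ (N+1)⁻¹ · 3/(πr³)`;
* `norm_momC_le_of_rhoC_le` — on such a thin cone `‖m_r‖ ≤ λ(1/2 + e_r)` once `ρ_r ≤ λ²`;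
* `entropy_cold_le` — THE COLD CORRECTION: for classical data `q₁, q₂` continuous on the strip `[0, b] × 𝕋³` and a
  nonnegative initial factor `g₀`, the (H3) functional with the shell's weight `Z'` exceeds the one with `Z` by at
  most `b · 2 Z_m λ (Q₁ + Q₂/2 + Q₂ ke)` (`Z_m = max |a| |b|`; the initial term only decreases since `Z' ≤ Z`), by
  kinetic domination (`spaceTime_bounds`).

No named fact is invoked.
-/

noncomputable section

namespace Summit.AtomisticToContinuum.HydrodynamicLimit.Theorems.ChaosClosesEulerReduction

open scoped BigOperators Topology Classical MeasureTheory InnerProductSpace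
open Filter Set MeasureTheory Function
open Literature.MathematicalPhysics.KineticTheory
open Literature.Analysis.FluidPDE
open Literature.Analysis.FunctionSpaces
open Summit.AtomisticToContinuum.HydrodynamicLimit.Theorems.LocalSecondLawNegative
open Summit.AtomisticToContinuum.HydrodynamicLimit.Theorems.LocalSecondLawLedger
open Summit.AtomisticToContinuum.HydrodynamicLimit.Theorems.LocalSecondLawLedger.L (rhoC_eq_sum)

variable {N : ℕ}

/-! ## §1 Cold cones hold one particle -/

/-- **A cone of nonpositive coarse temperature holds at most one particle.** On a configuration with pairwise
distinct velocities, `θ_r(x) ≤ 0` forces `ρ_r(x) ≤ (N+1)⁻¹ · 3/(πr³)`: `ρ_rθ_r = 0` makes every peculiar square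
`b_r(xᵢ, x)(vᵢ − u_r)²` vanish, so all particles of the cone share the coarse velocity, hence there is at most one.
[folklore] -/
theorem rhoC_le_of_thetaC_nonpos {r : ℝ} (hr : 0 < r) {w : Phase N}
    (hw : ∀ i j : Fin (N + 1), i ≠ j → (w i).2 ≠ (w j).2) {x : T3} (hθ : thetaC r w x ≤ 0) :
    rhoC r w x ≤ ((N + 1 : ℕ) : ℝ)⁻¹ * (3 / (Real.pi * r ^ 3)) := by
  have hn : (0 : ℝ) < ((N + 1 : ℕ) : ℝ)⁻¹ := by positivity
  by_cases hρ0 : rhoC r w x = 0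
  · rw [hρ0]; positivity
  have hρ : 0 < rhoC r w x := lt_of_le_of_ne (rhoC_nonneg hr w x) (Ne.symm hρ0)
  -- `ρ_r θ_r = 0`, so every peculiar square vanishes
  have hρθ : rhoC r w x * thetaC r w x = 0 :=
    le_antisymm (mul_nonpos_iff.2 (Or.inl ⟨hρ.le, hθ⟩)) (psvK_rhoC_mul_thetaC_nonneg hr w x)
  have hsum := psvK_sum_peculiar_sq_eq hr w x
  rw [hρθ, mul_zero] at hsum
  have hterm : ∀ (k : Fin 3) (i : Fin (N + 1)), cone r (w i).1 x * ((w i).2 k - uC r w x k) ^ 2 = 0 := by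
    intro k i
    have hk := (Finset.sum_eq_zero_iff_of_nonneg (fun k _ => mul_nonneg hn.le
      (Finset.sum_nonneg fun i _ => mul_nonneg (cone_nonneg hr _ _) (sq_nonneg _)))).1 hsum k (Finset.mem_univ k)
    have hk' : ∑ i, cone r (w i).1 x * ((w i).2 k - uC r w x k) ^ 2 = 0 := by
      rcases mul_eq_zero.1 hk with h | h
      · exact absurd h hn.ne'
      · exact h
    exact (Finset.sum_eq_zero_iff_of_nonneg fun i _ => mul_nonneg (cone_nonneg hr _ _) (sq_nonneg _)).1 hk' i
      (Finset.mem_univ i)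
  -- a particle inside the cone has the coarse velocity
  have hvel : ∀ i : Fin (N + 1), cone r (w i).1 x ≠ 0 → (w i).2 = uC r w x := by
    intro i hi
    refine PiLp.ext fun k => ?_
    rcases mul_eq_zero.1 (hterm k i) with h | h
    · exact absurd h hi
    · exact sub_eq_zero.1 ((pow_eq_zero_iff two_ne_zero).1 h)
  -- hence at most one particle lies inside
  obtain ⟨i₀, -, hi₀⟩ : ∃ i₀ ∈ (Finset.univ : Finset (Fin (N + 1))), cone r (w i₀).1 x ≠ 0 := by
    refine Finset.exists_ne_zero_of_sum_ne_zero fun h => hρ0 ?_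
    rw [rhoC_eq_sum, h, mul_zero]
  have hothers : ∀ j : Fin (N + 1), j ≠ i₀ → cone r (w j).1 x = 0 := by
    intro j hj
    by_contra hj0
    exact hw j i₀ hj ((hvel j hj0).trans (hvel i₀ hi₀).symm)
  rw [rhoC_eq_sum, Finset.sum_eq_single i₀ (fun j _ hj => hothers j hj) (fun h => absurd (Finset.mem_univ i₀) h)]
  exact mul_le_mul_of_nonneg_left (DensityCapNegative.cone_le hr _ _) hn.le

/-- **Momentum of a thin cone**: `ρ_r ≤ λ²` gives `‖m_r‖ ≤ λ(1/2 + e_r)` (admissibility `‖m_r‖² ≤ 2ρ_r e_r` and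
`2λ²e ≤ λ²(1/2 + e)²`). [folklore] -/
theorem norm_momC_le_of_rhoC_le {r : ℝ} (hr : 0 < r) (w : Phase N) (x : T3) {lam : ℝ} (hlam : 0 ≤ lam)
    (hρ : rhoC r w x ≤ lam ^ 2) : ‖momC r w x‖ ≤ lam * (1 / 2 + kinC r w x) := by
  have h1 := norm_momC_sq_le hr w x
  have hk := kinC_nonneg hr w x
  have h2 : ‖momC r w x‖ ^ 2 ≤ (lam * (1 / 2 + kinC r w x)) ^ 2 := by
    have h3 : 2 * rhoC r w x * kinC r w x ≤ 2 * lam ^ 2 * kinC r w x := by gcongr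
    nlinarith [sq_nonneg (lam * (kinC r w x - 1 / 2))]
  exact (pow_le_pow_iff_left₀ (norm_nonneg _) (by positivity) two_ne_zero).1 h2

/-- **Registered sub-goal `stub_reductionCold` (helper of `stub_kineticReduction`): the momentum of a thin cone**,
`‖m_r‖ ≤ λ(1/2 + e_r)` once `ρ_r ≤ λ²` — the pointwise input making the cold correction of the entropy hypothesis
kinetically dominated with a constant vanishing as `N → ∞` at fixed mollification radius. [folklore] -/
theorem stub_reductionCold : ∀ {N : ℕ} {r : ℝ}, 0 < r → ∀ (w : Config (N + 1) (Fin 3) T3) (x : T3) {lam : ℝ}, 0 ≤ lam → rhoC r w x ≤ lam ^ 2 → ‖momC r w x‖ ≤ lam * (1 / 2 + kinC r w x) :=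
  fun hr w x _ hlam hρ => norm_momC_le_of_rhoC_le hr w x hlam hρ

/-! ## §2 The cold correction of the entropy hypothesis -/

/-- Integrability of `ρ_r W g₀` over `𝕋³` for a bounded measurable weight and a bounded continuous factor.
[folklore] -/
theorem integrable_rho_weight {r : ℝ} (hr : 0 < r) (w : Phase N) {W g₀ : T3 → ℝ} (mW : Measurable W)
    {Zm : ℝ} (hW : ∀ x, |W x| ≤ Zm) (hg₀ : Continuous g₀) {G₀ : ℝ} (hG₀ : ∀ x, |g₀ x| ≤ G₀) :
    Integrable (fun x => rhoC r w x * W x * g₀ x) volume := by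
  refine Integrable.mono' (integrable_const (3 / (Real.pi * r ^ 3) * Zm * G₀))
    (((continuous_rhoC r w).measurable.mul mW).mul hg₀.measurable).aestronglyMeasurable (ae_of_all _ fun x => ?_)
  rw [Real.norm_eq_abs, abs_mul, abs_mul, abs_of_nonneg (rhoC_nonneg hr _ _)]
  have := rhoC_le hr w x; have := hW x; have := hG₀ x; have := rhoC_nonneg hr w x
  have : 0 ≤ Zm := (abs_nonneg _).trans (hW x)
  gcongr

set_option maxHeartbeats 1600000 in
/-- **THE COLD CORRECTION OF (H3).** Along a good orbit whose configurations have pairwise distinct velocities at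
all times, with `(N+1)⁻¹ · 3/(πr³) ≤ λ² ≤ 1`: for a weight `Z = max a (min (3/2 log θ_r − log ρ_r − F ρ_r) b)`
(`F` continuous on `(0, ∞)`), its cold modification `Z' = Z` on `{θ_r > 0}`, `Z' = a` on `{θ_r ≤ 0}`, classical data
`q₁, q₂` continuous on `[0, b] × 𝕋³` bounded by `Q₁, Q₂`, and a continuous initial factor `g₀ ≥ 0`:
`∫∫(ρ_r Z' q₁ + Z'⟪m_r, q₂⟫) + ∫ρ_r Z' g₀ ≤ ∫∫(ρ_r Z q₁ + Z⟪m_r, q₂⟫) + ∫ρ_r Z g₀ + b·2Z_mλ(Q₁ + Q₂/2 + Q₂ ke)`.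
[folklore] -/
theorem entropy_cold_le {σ : ℝ} (Φ : HardSphereFlow (Torus.geometry (Fin 3)) (hsDiameter σ N) (N + 1)) {z : Phase N}
    (hz : z ∈ Φ.good) {r : ℝ} (hr : 0 < r) (hr2 : r < 1 / 2) {b : ℝ} (hb : 0 ≤ b) {a₁ b₁ : ℝ} {F : ℝ → ℝ}
    (hF : ContinuousOn F (Ioi 0))
    (hdist : ∀ s : ℝ, ∀ i j : Fin (N + 1), i ≠ j → (Φ.flow s z i).2 ≠ (Φ.flow s z j).2)
    {lam : ℝ} (hlam : 0 < lam) (hlam1 : lam ≤ 1) (hκ : ((N + 1 : ℕ) : ℝ)⁻¹ * (3 / (Real.pi * r ^ 3)) ≤ lam ^ 2)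
    {q₁ : ℝ → T3 → ℝ} {q₂ : ℝ → T3 → V3}
    (hq₁ : ContinuousOn (uncurry q₁) (Icc 0 b ×ˢ univ)) (hq₂ : ContinuousOn (uncurry q₂) (Icc 0 b ×ˢ univ))
    {Q₁ Q₂ : ℝ} (hQ₁ : ∀ s ∈ Icc 0 b, ∀ x, |q₁ s x| ≤ Q₁) (hQ₂ : ∀ s ∈ Icc 0 b, ∀ x, ‖q₂ s x‖ ≤ Q₂)
    {g₀ : T3 → ℝ} (hg₀ : Continuous g₀) (hg₀0 : ∀ x, 0 ≤ g₀ x) {G₀ : ℝ} (hG₀ : ∀ x, |g₀ x| ≤ G₀) :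
    let Z : ℝ → T3 → ℝ := fun s x => max a₁ (min (3 / 2 * Real.log (thetaC r (Φ.flow s z) x) -
      Real.log (rhoC r (Φ.flow s z) x) - F (rhoC r (Φ.flow s z) x)) b₁)
    let Z' : ℝ → T3 → ℝ := fun s x => if 0 < thetaC r (Φ.flow s z) x then Z s x else a₁
    (∫ s in Icc 0 b, ∫ x, (rhoC r (Φ.flow s z) x * Z' s x * q₁ s x + Z' s x * ⟪momC r (Φ.flow s z) x, q₂ s x⟫_ℝ)) +
        ∫ x, rhoC r (Φ.flow 0 z) x * Z' 0 x * g₀ x ≤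
      (∫ s in Icc 0 b, ∫ x, (rhoC r (Φ.flow s z) x * Z s x * q₁ s x + Z s x * ⟪momC r (Φ.flow s z) x, q₂ s x⟫_ℝ)) +
        (∫ x, rhoC r (Φ.flow 0 z) x * Z 0 x * g₀ x) +
        (b - 0) * (2 * max |a₁| |b₁| * lam * (Q₁ + Q₂ / 2) + 2 * max |a₁| |b₁| * lam * Q₂ * ke z + 0) := by
  intro Z Z'
  -- ### measurability of the weights along the orbit
  obtain ⟨mρ, mm, -, -, -, mθ, mF⟩ := orbit_factors Φ hz hr hF
  have mZ : Measurable fun p : ℝ × T3 => Z p.1 p.2 :=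
    measurable_const.max ((((measurable_const.mul (Real.measurable_log.comp mθ)).sub
      (Real.measurable_log.comp mρ)).sub mF).min measurable_const)
  have mZ' : Measurable fun p : ℝ × T3 => Z' p.1 p.2 :=
    Measurable.ite (measurableSet_lt measurable_const mθ) mZ measurable_const
  set D : ℝ → T3 → ℝ := fun s x => Z' s x - Z s x with hDdef
  have mD : Measurable fun p : ℝ × T3 => D p.1 p.2 := mZ'.sub mZ
  have hZm0 : 0 ≤ max |a₁| |b₁| := le_max_of_le_left (abs_nonneg _)
  have hZb : ∀ s x, |Z s x| ≤ max |a₁| |b₁| := fun s x => abs_clamp_le _ _ _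
  have hZ'b : ∀ s x, |Z' s x| ≤ max |a₁| |b₁| := fun s x => by
    show |(if 0 < thetaC r (Φ.flow s z) x then Z s x else a₁)| ≤ max |a₁| |b₁|
    split_ifs
    · exact hZb s x
    · exact le_max_left _ _
  have hZ'le : ∀ s x, Z' s x ≤ Z s x := fun s x => by
    show (if 0 < thetaC r (Φ.flow s z) x then Z s x else a₁) ≤ Z s x
    split_ifs
    · exact le_rfl
    · exact le_max_left _ _
  have hDb : ∀ s x, |D s x| ≤ 2 * max |a₁| |b₁| := fun s x => by
    have h1 := hZb s x; have h2 := hZ'b s x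
    calc |D s x| = |Z' s x - Z s x| := rfl
      _ ≤ |Z' s x| + |Z s x| := abs_sub _ _
      _ ≤ 2 * max |a₁| |b₁| := by linarith
  have hQ₁0 : 0 ≤ Q₁ := (abs_nonneg _).trans (hQ₁ 0 ⟨le_rfl, hb⟩ 0)
  have hQ₂0 : 0 ≤ Q₂ := (norm_nonneg _).trans (hQ₂ 0 ⟨le_rfl, hb⟩ 0)
  have hlam2 : lam ^ 2 ≤ lam := by nlinarith
  -- ### pointwise: the correction vanishes on warm cones and is thin on cold ones
  have hcorr : ∀ s ∈ Icc 0 b, ∀ x, |rhoC r (Φ.flow s z) x * D s x * q₁ s x + D s x * ⟪momC r (Φ.flow s z) x, q₂ s x⟫_ℝ| ≤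
      2 * max |a₁| |b₁| * lam * (Q₁ + Q₂ / 2) + 2 * max |a₁| |b₁| * lam * Q₂ * kinC r (Φ.flow s z) x +
        0 * rhoC r (Φ.flow s z) x := by
    intro s hs x
    have hk := kinC_nonneg hr (Φ.flow s z) x
    by_cases hθ : 0 < thetaC r (Φ.flow s z) x
    · have hD0 : D s x = 0 := by
        show (if 0 < thetaC r (Φ.flow s z) x then Z s x else a₁) - Z s x = 0
        rw [if_pos hθ, sub_self]
      rw [hD0, zero_mul]; simp only [mul_zero, zero_mul, abs_zero, add_zero]
      positivity
    · have hρ := (rhoC_le_of_thetaC_nonpos hr (hdist s) (not_lt.1 hθ)).trans hκ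
      have hm := norm_momC_le_of_rhoC_le hr _ x hlam.le hρ
      have hρ0 := rhoC_nonneg hr (Φ.flow s z) x
      have hq1 := hQ₁ s hs x; have hq2 := hQ₂ s hs x; have hd := hDb s x
      have hi : |⟪momC r (Φ.flow s z) x, q₂ s x⟫_ℝ| ≤ ‖momC r (Φ.flow s z) x‖ * ‖q₂ s x‖ := abs_real_inner_le_norm _ _
      calc _ ≤ |rhoC r (Φ.flow s z) x * D s x * q₁ s x| + |D s x * ⟪momC r (Φ.flow s z) x, q₂ s x⟫_ℝ| := abs_add_le _ _
        _ = rhoC r (Φ.flow s z) x * |D s x| * |q₁ s x| + |D s x| * |⟪momC r (Φ.flow s z) x, q₂ s x⟫_ℝ| := by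
            rw [abs_mul, abs_mul, abs_mul, abs_of_nonneg hρ0]
        _ ≤ lam ^ 2 * (2 * max |a₁| |b₁|) * Q₁ + (2 * max |a₁| |b₁|) * ((lam * (1 / 2 + kinC r (Φ.flow s z) x)) * Q₂) := by
            gcongr
            exact hi.trans (by gcongr)
        _ ≤ lam * (2 * max |a₁| |b₁|) * Q₁ + (2 * max |a₁| |b₁|) * ((lam * (1 / 2 + kinC r (Φ.flow s z) x)) * Q₂) := by
            gcongr
        _ = _ := by ring
  -- ### kinetic domination of both integrands
  have hstripD : AEStronglyMeasurable (uncurry fun s x => rhoC r (Φ.flow s z) x * D s x * q₁ s x +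
      D s x * ⟪momC r (Φ.flow s z) x, q₂ s x⟫_ℝ) ((volume.restrict (Icc 0 b)).prod volume) :=
    (aemeasurable_entropy_recipe mρ.aemeasurable mD.aemeasurable (classical_factor hq₁).1.aemeasurable
      mm.aemeasurable (classical_factor hq₂).1.aemeasurable).aestronglyMeasurable
  have hsecD : ∀ s ∈ Icc 0 b, AEStronglyMeasurable (fun x => rhoC r (Φ.flow s z) x * D s x * q₁ s x +
      D s x * ⟪momC r (Φ.flow s z) x, q₂ s x⟫_ℝ) volume := fun s hs =>
    (aemeasurable_entropy_recipe (orbit_factor mρ b |>.2 s).aemeasurable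
      ((mD.comp (measurable_const.prodMk measurable_id)).aemeasurable)
      ((classical_factor hq₁).2 s hs).measurable.aemeasurable (orbit_factor mm b |>.2 s).aemeasurable
      ((classical_factor hq₂).2 s hs).measurable.aemeasurable).aestronglyMeasurable
  obtain ⟨ic, -, pc, bc⟩ := spaceTime_bounds Φ hz hr hr2 hb hstripD hsecD (by positivity) le_rfl hcorr
  have hstripZ : AEStronglyMeasurable (uncurry fun s x => rhoC r (Φ.flow s z) x * Z s x * q₁ s x +
      Z s x * ⟪momC r (Φ.flow s z) x, q₂ s x⟫_ℝ) ((volume.restrict (Icc 0 b)).prod volume) :=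
    (aemeasurable_entropy_recipe mρ.aemeasurable mZ.aemeasurable (classical_factor hq₁).1.aemeasurable
      mm.aemeasurable (classical_factor hq₂).1.aemeasurable).aestronglyMeasurable
  have hsecZ : ∀ s ∈ Icc 0 b, AEStronglyMeasurable (fun x => rhoC r (Φ.flow s z) x * Z s x * q₁ s x +
      Z s x * ⟪momC r (Φ.flow s z) x, q₂ s x⟫_ℝ) volume := fun s hs =>
    (aemeasurable_entropy_recipe (orbit_factor mρ b |>.2 s).aemeasurable
      ((mZ.comp (measurable_const.prodMk measurable_id)).aemeasurable)
      ((classical_factor hq₁).2 s hs).measurable.aemeasurable (orbit_factor mm b |>.2 s).aemeasurable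
      ((classical_factor hq₂).2 s hs).measurable.aemeasurable).aestronglyMeasurable
  obtain ⟨i6, -, p6, -⟩ := spaceTime_bounds Φ hz hr hr2 hb hstripZ hsecZ (C₁ := 0)
    (C₂ := max |a₁| |b₁| * Q₂) (C₃ := max |a₁| |b₁| * Q₁ + max |a₁| |b₁| * Q₂ / 2) (by positivity) (by positivity)
    fun s hs x => by
      have h := abs_entropyIntegrand_le hr (Φ.flow s z) x (hZb s x) (hQ₁ s hs x) (hQ₂ s hs x)
      linarith
  -- ### splitting the primed functional
  have hsplit : ∀ s x, rhoC r (Φ.flow s z) x * Z' s x * q₁ s x + Z' s x * ⟪momC r (Φ.flow s z) x, q₂ s x⟫_ℝ =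
      (rhoC r (Φ.flow s z) x * Z s x * q₁ s x + Z s x * ⟪momC r (Φ.flow s z) x, q₂ s x⟫_ℝ) +
      (rhoC r (Φ.flow s z) x * D s x * q₁ s x + D s x * ⟪momC r (Φ.flow s z) x, q₂ s x⟫_ℝ) := by
    intro s x; simp only [hDdef]; ring
  have hx : EqOn (fun s => ∫ x, (rhoC r (Φ.flow s z) x * Z' s x * q₁ s x + Z' s x * ⟪momC r (Φ.flow s z) x, q₂ s x⟫_ℝ))
      (fun s => (∫ x, (rhoC r (Φ.flow s z) x * Z s x * q₁ s x + Z s x * ⟪momC r (Φ.flow s z) x, q₂ s x⟫_ℝ)) +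
        ∫ x, (rhoC r (Φ.flow s z) x * D s x * q₁ s x + D s x * ⟪momC r (Φ.flow s z) x, q₂ s x⟫_ℝ)) (Icc 0 b) := by
    intro s hs
    beta_reduce
    rw [← integral_add (i6 s hs) (ic s hs)]
    exact integral_congr_ae (ae_of_all _ fun x => hsplit s x)
  rw [setIntegral_congr_fun measurableSet_Icc hx, integral_add p6 pc]
  -- ### the initial term only decreases
  have mZ0' := mZ.comp (measurable_const.prodMk measurable_id : Measurable fun x : T3 => ((0 : ℝ), x))
  have mZ'0' := mZ'.comp (measurable_const.prodMk measurable_id : Measurable fun x : T3 => ((0 : ℝ), x))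
  simp only [Function.comp_def] at mZ0' mZ'0'
  have hinit : ∫ x, rhoC r (Φ.flow 0 z) x * Z' 0 x * g₀ x ≤ ∫ x, rhoC r (Φ.flow 0 z) x * Z 0 x * g₀ x := by
    refine integral_mono (integrable_rho_weight hr _ mZ'0' (fun x => hZ'b 0 x) hg₀ hG₀)
      (integrable_rho_weight hr _ mZ0' (fun x => hZb 0 x) hg₀ hG₀) fun x => ?_
    have h1 := hZ'le 0 x
    have h2 := mul_nonneg (rhoC_nonneg hr (Φ.flow 0 z) x) (hg₀0 x)
    beta_reduce
    nlinarith
  have habs := le_abs_self (∫ s in Icc 0 b, ∫ x, (rhoC r (Φ.flow s z) x * D s x * q₁ s x + D s x * ⟪momC r (Φ.flow s z) x, q₂ s x⟫_ℝ))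
  linarith

end Summit.AtomisticToContinuum.HydrodynamicLimit.Theorems.ChaosClosesEulerReduction

end
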